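import Mathlib
import Summits.NavierStokesRegularity.NavierStokesRegularity.Theorems.SqueezeCycleMustSqueezeGronwall
import Literature.Analysis.FluidPDE.HyperbolicDSSOrbit
import Literature.Analysis.Fourier.RadialSchwartzInterpolationTruncation

/-!
# drefute evidence — `stub_finiteEnstrophy` of line `outward-drift-signed-flux` is a TRUE real-variable lemma

Abstract form over arbitrary families `Z E : ℝ → ℝ → ℝ` (radius first, similarity time second), so that it
discharges the registered stub for ANY bodies of `locEnstrophy` / `ballGradEnergy` once `0 ≤ ballGradEnergy`
(an integral of squares) is supplied: `stub_finiteEnstrophy` = `finiteEnstrophy_abstract` with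
`Z := locEnstrophy u`, `E := ballGradEnergy u`.  Engine: the tree's `Theorems.backward_gronwall_bound`
(backward Grönwall with `L¹_unif` forcing) + `√x ≤ x + ¼` + the Chebyshev average `∫_s^{s+1} Z_R ≤ 24 C R`.
-/

noncomputable section

open MeasureTheory Set Filter Real intervalIntegral

namespace Drefute

/-- `√x ≤ x + ¼` (`(√x − ½)² ≥ 0`). -/
theorem sqrt_le_add_quarter {x : ℝ} (hx : 0 ≤ x) : Real.sqrt x ≤ x + 1 / 4 := by
  nlinarith [Real.sq_sqrt hx, Real.sqrt_nonneg x, sq_nonneg (Real.sqrt x - 1 / 2)]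

/-- **`stub_finiteEnstrophy`, abstract form.**  If for every `R ≥ 1` the quantity `Z R` obeys the damped
inequality `(Z R)' ≤ −2(¼ − a) Z R + K_R` with a continuous forcing `0 ≤ K_R ≤ κ (E(2R)/R + √(E(2R)/R))`,
the unit-time integrals of `E ρ` are `≤ 2 C ρ` (`ρ ≥ 1`), `E ≥ 0`, and `Z R ≤ 6 E(2R)`, then `Z R s ≤ K₁`
uniformly in `R ≥ 1` and `s`, with `K₁ = |κ| (8C + ¼) / (1 − e^{−2(¼−a)})`. -/
theorem finiteEnstrophy_abstract {Z E : ℝ → ℝ → ℝ} {C a κ : ℝ} (ha : a < 1 / 4)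
    (hE0 : ∀ ρ s, 0 ≤ E ρ s)
    (hbudget : ∀ R : ℝ, 1 ≤ R → Differentiable ℝ (Z R) ∧ ∃ K : ℝ → ℝ, Continuous K ∧ (∀ s, 0 ≤ K s) ∧
      (∀ s, K s ≤ κ * (E (2 * R) s / R + Real.sqrt (E (2 * R) s / R))) ∧
      ∀ s, deriv (Z R) s ≤ -(2 * (1 / 4 - a)) * Z R s + K s)
    (hEc : ∀ ρ : ℝ, 0 < ρ → Continuous (E ρ))
    (hEavg : ∀ (s ρ : ℝ), 1 ≤ ρ → ∫ σ in s..(s + 1), E ρ σ ≤ 2 * C * ρ)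
    (hZE : ∀ R s : ℝ, 1 ≤ R → Z R s ≤ 6 * E (2 * R) s) :
    ∃ K₁ : ℝ, ∀ R s : ℝ, 1 ≤ R → Z R s ≤ K₁ := by
  have hc : 0 < 2 * (1 / 4 - a) := by linarith
  -- `0 ≤ C` from the averaged bound at `ρ = 1`
  have hC : 0 ≤ C := by
    have h := hEavg 0 1 le_rfl
    have h0 : 0 ≤ ∫ σ in (0 : ℝ)..(0 + 1), E 1 σ :=
      intervalIntegral.integral_nonneg (by norm_num) fun σ _ => hE0 1 σ
    linarith
  refine ⟨|κ| * (8 * C + 1 / 4) / (1 - Real.exp (-(2 * (1 / 4 - a)))), fun R s hR => ?_⟩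
  obtain ⟨hZd, K, hKc, hK0, hKle, hineq⟩ := hbudget R hR
  have hR0 : 0 < R := by linarith
  have hE2c : Continuous (E (2 * R)) := hEc _ (by linarith)
  -- the averaged gradient bound at radius `2R`
  have hEint : ∀ s, ∫ σ in s..(s + 1), E (2 * R) σ ≤ 4 * C * R := by
    intro s
    have h := hEavg s (2 * R) (by linarith)
    linarith
  -- unit bounds on `|K|`
  have hKB : ∀ s, ∫ σ in s..(s + 1), |K σ| ≤ |κ| * (8 * C + 1 / 4) := by
    intro s
    have hpt : ∀ σ, |K σ| ≤ 2 * |κ| / R * E (2 * R) σ + |κ| / 4 := by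
      intro σ
      rw [abs_of_nonneg (hK0 σ)]
      have hx : 0 ≤ E (2 * R) σ / R := div_nonneg (hE0 _ _) hR0.le
      have hXnn : 0 ≤ E (2 * R) σ / R + Real.sqrt (E (2 * R) σ / R) := add_nonneg hx (Real.sqrt_nonneg _)
      have h1 : K σ ≤ |κ| * (E (2 * R) σ / R + Real.sqrt (E (2 * R) σ / R)) :=
        (hKle σ).trans (mul_le_mul_of_nonneg_right (le_abs_self κ) hXnn)
      have h2 : Real.sqrt (E (2 * R) σ / R) ≤ E (2 * R) σ / R + 1 / 4 := sqrt_le_add_quarter hx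
      have h3 : |κ| * (E (2 * R) σ / R + Real.sqrt (E (2 * R) σ / R)) ≤
          |κ| * (2 * (E (2 * R) σ / R) + 1 / 4) :=
        mul_le_mul_of_nonneg_left (by linarith) (abs_nonneg κ)
      have h4 : |κ| * (2 * (E (2 * R) σ / R) + 1 / 4) = 2 * |κ| / R * E (2 * R) σ + |κ| / 4 := by
        field_simp
      linarith
    have hgc : Continuous fun σ => 2 * |κ| / R * E (2 * R) σ + |κ| / 4 :=
      (continuous_const.mul hE2c).add continuous_const
    have hfi : IntervalIntegrable (fun σ => |K σ|) volume s (s + 1) :=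
      (continuous_abs.comp hKc).intervalIntegrable _ _
    have hgi : IntervalIntegrable (fun σ => 2 * |κ| / R * E (2 * R) σ + |κ| / 4) volume s (s + 1) :=
      hgc.intervalIntegrable _ _
    have hmono : ∫ σ in s..(s + 1), |K σ| ≤ ∫ σ in s..(s + 1), (2 * |κ| / R * E (2 * R) σ + |κ| / 4) :=
      intervalIntegral.integral_mono_on (μ := volume) (a := s) (b := s + 1) (by linarith) hfi hgi
        (fun σ _ => hpt σ)
    have hf1 : IntervalIntegrable (fun σ => 2 * |κ| / R * E (2 * R) σ) volume s (s + 1) :=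
      (continuous_const.mul hE2c).intervalIntegrable _ _
    have hf2 : IntervalIntegrable (fun _ : ℝ => |κ| / 4) volume s (s + 1) := intervalIntegrable_const
    have hcalc : ∫ σ in s..(s + 1), (2 * |κ| / R * E (2 * R) σ + |κ| / 4) =
        2 * |κ| / R * (∫ σ in s..(s + 1), E (2 * R) σ) + |κ| / 4 := by
      rw [intervalIntegral.integral_add hf1 hf2, intervalIntegral.integral_const_mul,
        intervalIntegral.integral_const, smul_eq_mul]
      ring
    have hcoef : 0 ≤ 2 * |κ| / R := div_nonneg (by positivity) hR0.le
    have h5 : 2 * |κ| / R * (∫ σ in s..(s + 1), E (2 * R) σ) ≤ 2 * |κ| / R * (4 * C * R) :=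
      mul_le_mul_of_nonneg_left (hEint s) hcoef
    have h6 : 2 * |κ| / R * (4 * C * R) = 8 * |κ| * C := by
      field_simp
      ring
    calc ∫ σ in s..(s + 1), |K σ| ≤ ∫ σ in s..(s + 1), (2 * |κ| / R * E (2 * R) σ + |κ| / 4) := hmono
      _ = 2 * |κ| / R * (∫ σ in s..(s + 1), E (2 * R) σ) + |κ| / 4 := hcalc
      _ ≤ 8 * |κ| * C + |κ| / 4 := by linarith
      _ = |κ| * (8 * C + 1 / 4) := by ring
  -- bounded unit averages of `Z R` (Chebyshev input): `∫ Z R ≤ 6 ∫ E(2R) ≤ 24 C R`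
  have hZavg : ∃ A, ∀ s, ∫ σ in s..(s + 1), Z R σ ≤ A := by
    refine ⟨24 * C * R, fun s => ?_⟩
    have hf1 : IntervalIntegrable (fun σ => Z R σ) volume s (s + 1) := hZd.continuous.intervalIntegrable _ _
    have hf2 : IntervalIntegrable (fun σ => 6 * E (2 * R) σ) volume s (s + 1) :=
      (continuous_const.mul hE2c).intervalIntegrable _ _
    have hmono : ∫ σ in s..(s + 1), Z R σ ≤ ∫ σ in s..(s + 1), 6 * E (2 * R) σ :=
      intervalIntegral.integral_mono_on (μ := volume) (a := s) (b := s + 1) (by linarith) hf1 hf2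
        (fun σ _ => hZE R σ hR)
    have hcm : ∫ σ in s..(s + 1), 6 * E (2 * R) σ = 6 * ∫ σ in s..(s + 1), E (2 * R) σ :=
      intervalIntegral.integral_const_mul _ _
    linarith [hEint s]
  have hineq' : ∀ s, deriv (Z R) s ≤ -(2 * (1 / 4 - a)) * Z R s + K s := hineq
  exact Summit.NavierStokesRegularity.NavierStokesRegularity.Theorems.backward_gronwall_bound hc hZd hineq'
    hKc hKB hZavg s


/-! ## Instantiation: the registered signature of `stub_finiteEnstrophy`, verbatim, for the reconstructed bodies

(the only extra input is `0 ≤ ballGradEnergy u ρ s`, a `setIntegral` of a square — true for ANY body of that shape). -/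

section Instantiation
open Literature.Analysis.FluidPDE


local notation "ℝ³" => EuclideanSpace ℝ (Fin 3)

def locEnstrophy (u : ℝ → ℝ³ → ℝ³) (R s : ℝ) : ℝ :=
  ∫ y, Literature.Analysis.Fourier.radialCutoff R y * ‖lerayVorticity u s y‖ ^ 2

def ballGradEnergy (u : ℝ → ℝ³ → ℝ³) (ρ s : ℝ) : ℝ :=
  ∫ y in Metric.ball (0 : ℝ³) ρ, ‖fderiv ℝ (lerayOrbit u s) y‖ ^ 2

theorem ballGradEnergy_nonneg (u : ℝ → ℝ³ → ℝ³) (ρ s : ℝ) : 0 ≤ ballGradEnergy u ρ s :=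
  setIntegral_nonneg measurableSet_ball fun _ _ => by positivity

/-- The registered stub, verbatim signature, proved. -/
theorem stub_finiteEnstrophy :
    ∀ (C a κ : ℝ) (u : ℝ → ℝ³ → ℝ³), a < 1 / 4 → (∀ R : ℝ, 1 ≤ R → Differentiable ℝ (locEnstrophy u R) ∧ ∃ K : ℝ → ℝ, Continuous K ∧ (∀ s, 0 ≤ K s) ∧ (∀ s, K s ≤ κ * (ballGradEnergy u (2 * R) s / R + Real.sqrt (ballGradEnergy u (2 * R) s / R))) ∧ ∀ s, deriv (locEnstrophy u R) s ≤ -(2 * (1 / 4 - a)) * locEnstrophy u R s + K s) → (∀ ρ : ℝ, 0 < ρ → Continuous (ballGradEnergy u ρ)) → (∀ (s ρ : ℝ), 1 ≤ ρ → ∫ σ in s..(s + 1), ballGradEnergy u ρ σ ≤ 2 * C * ρ) → (∀ R s : ℝ, 1 ≤ R → locEnstrophy u R s ≤ 6 * ballGradEnergy u (2 * R) s) → ∃ K₁ : ℝ, ∀ R s : ℝ, 1 ≤ R → locEnstrophy u R s ≤ K₁ :=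
  fun _C _a _κ u ha hbudget hEc hEavg hZE =>
    finiteEnstrophy_abstract (Z := locEnstrophy u) (E := ballGradEnergy u) ha (ballGradEnergy_nonneg u)
      hbudget hEc hEavg hZE


end Instantiation

end Drefute
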